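import Summits.QuantumFields.BalabanUV.T4Continuum.Support.NE7OneStepOfRoutePi
import Summits.QuantumFields.BalabanUV.T4Continuum.Support.NE7ExactCurrent
import HarnessLib

/-!
# NE7TangentTransport — THE TEST-FIELD TRANSPORT LETTER (TT) OF F38's BUNDLE IN KERNEL MODULO ONE DISPLAYED ℓ¹ LETTER: every skew periodic
# direction `Y` is corrected to a TANGENT direction `Y′ = Y − R_U(D_U Y)` at `U` by row NE3's exact curved right inverse, with first-variation defect
# `|dAction U (Y′ − Y)| ≤ a·(curl1C∕(1−θℓ))·M^{d−2}·‖D_U Y‖_{ℓ¹}` (F3's radius bound × (R3))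

Cell `pub-balaban`, rung (B)+1 sub-cell t4, lineage `b2b-balaban-t4-ne7-p1`, generation 70 (CRUX PROVER NE7 #1); memo
`t4/b2b-balaban-t4-ne7-p1-g70/HUNT-H14-APE-FLAT-SKELETON.md` §3 (row TT), §5 (2).  File F41 (over row NE3's `NE3RightInverseLetters` (`rightInvW_exact ∕ _skew ∕
_periodic`, (R3) `sum_norm_curl_rightInvW_le`), `NE3EnergyRateWSupRoutePiRInv` (`dirIter_skew`, `isPeriodicDir_dirIter`), `NE3ResidualSliceRep.dirIter_sub`,
gen 66's F3 `NE7OneStepLetters.abs_dAction_le_radius_mul` and `NE7ExactCurrent.dAction_smul`).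
WHY.  F38 `NE7ApeFlatSkeleton.smallField_vary_of_flatLetters` tests criticality at the representative `Ũ` on tangent directions at `Ũ`, while the slice
solver works with tangent directions at the flat reference `F̃`; the letter (TT) transports one to the other with an `(ℓ¹)*` defect of density `τ`.  THIS FILE
proves (TT) with `τ = a·(curl1C∕(1−θℓ))·M^{d−2}·Λ` from ONE displayed letter `hLip`: `‖D_Ũ Y‖_{ℓ¹(periodBox N)} ≤ Λ·‖Y‖_{ℓ¹(periodBox (N·M))}` for
tangent-at-`F̃` directions `Y` — in nature `Λ ∼ C_E·α̂·M^{1−d}` (the Lipschitz dependence of `D_W = dirIter L (k+1) W` on `W`, since `D_{F̃}Y = 0`), so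
`τ ∼ a·c·α̂·M⁻¹ = δα̂·c·M⁻³` at `a = δM⁻²` — the currency `τ̂M⁻³` of F38 §3.
WHAT ([folklore]; 0 def, 0 sorry).  §1 **`tangent_correction`** — at a unitary `(N·L^{k+1})`-periodic `U` in the multi-level class with the W5∕W6
regime: for every skew `(N·L^{k+1})`-periodic `Y`, `Y′ := Y − rightInvW …(D_U Y)` is skew, periodic, TANGENT (`D_U Y′ = 0`), and
`|dAction U (Y′ − Y) (perWin)| ≤ a·(curl1C∕(1−θℓ))·(M^d∕M²)·dirL1 (D_U Y) (periodBox N)` when `SmallField U a`.  §2 **`hTT_of_dirL1_letter`** — F38's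
`hTT` hypothesis shape VERBATIM (at `P = N·L^{k+1}`) from the displayed letter `hLip`.
HONEST FRAMING (page 1): composition of row NE3's kernel right inverse with F3; the ℓ¹ letter `hLip` (Lipschitz of `D_W` in `W`) is DISPLAYED, not proved;
nothing of Bałaban's asserted; NOT (APE), NOT ONE-STEP, NOT NE7; spine 0∕9; finite T⁴ rung (B)+1 — NOT infinite volume, NOT mass gap, NOT Clay.  Continuum YM
on T⁴ ⇐ BetaPertH ∧ nine spine estimates (0/9 proved); BetaPertH ⇐ (D1) ∧ (D4) ∧ CAP+tail; G-an2-4 gates asym, D1 and NE2/3/4.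
-/

set_option autoImplicit false

open scoped BigOperators Matrix.Norms.L2Operator
open NormedSpace Finset Set

namespace Summit.QuantumFields.BalabanUV.T4Continuum.NE7TangentTransport

open Literature.MathematicalPhysics.QuantumFieldTheory.Balaban1983to89
open B7Prop1Explicit B7Prop2Explicit MatrixLog UnitaryModel
open T4AveragingDeficitWall (IsUnitaryCfg IsSkewDir SmallField curl dirL1)
open T4AveragingDeficitWallBoundary (IsPeriodicCfg periodBox)
open AveragingDeficitPeriodicCounting (IsPeriodicDir)
open AveragingDeficitMultiLevelPrep (LevelSmall tower)
open AveragingDeficitMultiLevelBridge (tower_eq)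
open MinimalActionLevels (perWin)
open NE3HessForm (dAction)
open NE3TangentCovariantTower (dirIter)
open NE3QbarIterCovLiftPrep (cruxC)
open NE3SmoothRightInverseW (rightInvW)
open NE3RightInverseSolveLetters (thetaLoc)
open NE3HatInvCurlLetters (curl1C curl1C_nonneg)
open NE3RightInverseLetters (rightInvW_exact rightInvW_skew rightInvW_periodic sum_norm_curl_rightInvW_le)
open NE3EnergyRateWSupRoutePiRInv (dirIter_skew isPeriodicDir_dirIter)
open NE3ResidualSliceRep (dirIter_sub)
open NE7OneStepLetters (abs_dAction_le_radius_mul)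
open NE7ExactCurrent (dAction_smul)

noncomputable section

variable {d : ℕ} {n : Type*} [Fintype n] [DecidableEq n]

/-! ## §1 The tangent correction by the exact curved right inverse -/

/-- **THE TANGENT CORRECTION.**  `U` unitary, `(N·L^{k+1})`-periodic, in the multi-level class radius `x` with the W5∕W6 regime
(`cruxC·M²x < 1`, `thetaLoc·M²x < 1`, `M²x ≤ 1`), `SmallField U a`; `Y` skew `(N·L^{k+1})`-periodic.  Then `Y′ := Y − rightInvW …(D_U Y)` is skew,
`(N·L^{k+1})`-periodic, TANGENT at `U`, and `|dAction U (Y′ − Y) (perWin d (N·L^{k+1}))| ≤ a·(curl1C∕(1−θℓ))·(M^d∕M²)·‖D_U Y‖_{ℓ¹(periodBox N)}`.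
[folklore] -/
theorem tangent_correction [Nonempty n] {L : ℕ} (hL : 2 ≤ L) (k : ℕ) {N : ℕ} [NeZero N] {U : Site d → Fin d → (Matrix n n ℂ)ˣ} {x a : ℝ}
    (hUu : IsUnitaryCfg U) (hUP : IsPeriodicCfg U ((N * L ^ (k + 1) : ℕ) : ℤ)) (hx : 0 ≤ x) (hs : LevelSmall d L k x) (hUx : SmallField U x)
    (hθ : cruxC d L * (((L : ℝ) ^ (k + 1)) ^ 2 * x) < 1) (hθl : thetaLoc d L * (((L : ℝ) ^ (k + 1)) ^ 2 * x) < 1)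
    (hε : ((L : ℝ) ^ (k + 1)) ^ 2 * x ≤ 1) (ha : 0 ≤ a) (hUa : SmallField U a)
    {Y : Site d → Fin d → Matrix n n ℂ} (hY : IsSkewDir Y) (hYP : IsPeriodicDir Y ((N * L ^ (k + 1) : ℕ) : ℤ)) :
    ∃ Y' : Site d → Fin d → Matrix n n ℂ, IsSkewDir Y' ∧ IsPeriodicDir Y' ((N * L ^ (k + 1) : ℕ) : ℤ) ∧ dirIter L (k + 1) U Y' = 0 ∧
      |dAction U (fun y μ => Y' y μ - Y y μ) (perWin d (N * L ^ (k + 1)))|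
        ≤ a * ((curl1C d L / (1 - thetaLoc d L * (((L : ℝ) ^ (k + 1)) ^ 2 * x))) * (((L : ℝ) ^ (k + 1)) ^ d / ((L : ℝ) ^ (k + 1)) ^ 2)
            * dirL1 (dirIter L (k + 1) U Y) (periodBox (d := d) N)) := by
  have hL1 : 1 ≤ L := le_trans (by norm_num) hL
  -- the datum `φ := D_U Y` is skew and `N`-periodic
  have htow : ((tower L N (k + 1) : ℕ) : ℤ) = ((N * L ^ (k + 1) : ℕ) : ℤ) := by rw [tower_eq]
  have hUP' : IsPeriodicCfg U ((tower L N (k + 1) : ℕ) : ℤ) := by rw [htow]; exact hUP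
  have hYP' : IsPeriodicDir Y ((tower L N (k + 1) : ℕ) : ℤ) := by rw [htow]; exact hYP
  have hφ : IsSkewDir (dirIter L (k + 1) U Y) := dirIter_skew hL1 k hUu hx hs hUx hY
  have hφP : IsPeriodicDir (dirIter L (k + 1) U Y) (N : ℤ) := isPeriodicDir_dirIter L N (k + 1) hUP' hYP'
  -- the correction
  set Z := rightInvW hL k hUu hx hs hUx N hθ hφ with hZ
  have hZs : IsSkewDir Z := rightInvW_skew hL k hUu hx hs hUx hθ hφ
  have hZP : IsPeriodicDir Z ((N * L ^ (k + 1) : ℕ) : ℤ) := rightInvW_periodic hL k hUu hUP' hx hs hUx hθ hφ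
  have hZe : dirIter L (k + 1) U Z = dirIter L (k + 1) U Y := rightInvW_exact hL k hUu hUP' hx hs hUx hθ hφ hφP
  refine ⟨fun y μ => Y y μ - Z y μ, fun y μ => (skewAdjoint (Matrix n n ℂ)).sub_mem (hY y μ) (hZs y μ),
    fun y i μ => by simp only [hYP y i μ, hZP y i μ], ?_, ?_⟩
  · rw [dirIter_sub hL1 k hUu hx hs hUx Y Z, hZe]
    funext z κ
    simp
  · -- `Y′ − Y = −Z`
    have hdiff : (fun y μ => (Y y μ - Z y μ) - Y y μ) = (-1 : ℝ) • Z := by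
      funext y μ
      simp
    rw [hdiff, dAction_smul, neg_one_mul, abs_neg]
    have h3 := abs_dAction_le_radius_mul hUu hZs hUa (perWin d (N * L ^ (k + 1)))
    have hR3 := sum_norm_curl_rightInvW_le hL k hUu hUP' hx hs hUx hθ hθl hε hφ
    refine h3.trans ?_
    have h4 := mul_le_mul_of_nonneg_left hR3 ha
    simpa only [hZ, mul_assoc] using h4

/-! ## §2 F38's `hTT` from the ℓ¹ letter -/

/-- **(TT) OF F38's BUNDLE FROM ONE DISPLAYED ℓ¹ LETTER.**  Under §1's hypotheses on the representative `U` and the letter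
`hLip : ‖D_U Y‖_{ℓ¹(periodBox N)} ≤ Λ·‖Y‖_{ℓ¹(periodBox (N·L^{k+1}))}` for every skew periodic `Y` tangent at the flat reference (`D_{F̃} Y = 0`), F38's
hypothesis `hTT` holds with `τ = a·(curl1C∕(1−θℓ))·(M^d∕M²)·Λ`. [folklore] -/
theorem hTT_of_dirL1_letter [Nonempty n] {L : ℕ} (hL : 2 ≤ L) (k : ℕ) {N : ℕ} [NeZero N] {U Ft : Site d → Fin d → (Matrix n n ℂ)ˣ} {x a Λ : ℝ}
    (hUu : IsUnitaryCfg U) (hUP : IsPeriodicCfg U ((N * L ^ (k + 1) : ℕ) : ℤ)) (hx : 0 ≤ x) (hs : LevelSmall d L k x) (hUx : SmallField U x)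
    (hθ : cruxC d L * (((L : ℝ) ^ (k + 1)) ^ 2 * x) < 1) (hθl : thetaLoc d L * (((L : ℝ) ^ (k + 1)) ^ 2 * x) < 1)
    (hε : ((L : ℝ) ^ (k + 1)) ^ 2 * x ≤ 1) (ha : 0 ≤ a) (hUa : SmallField U a)
    (hLip : ∀ Y : Site d → Fin d → Matrix n n ℂ, IsSkewDir Y → IsPeriodicDir Y ((N * L ^ (k + 1) : ℕ) : ℤ) → dirIter L (k + 1) Ft Y = 0 →
      dirL1 (dirIter L (k + 1) U Y) (periodBox (d := d) N) ≤ Λ * dirL1 Y (periodBox (d := d) (N * L ^ (k + 1)))) :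
    ∀ Y : Site d → Fin d → Matrix n n ℂ, IsSkewDir Y → IsPeriodicDir Y ((N * L ^ (k + 1) : ℕ) : ℤ) → dirIter L (k + 1) Ft Y = 0 →
      ∃ Y' : Site d → Fin d → Matrix n n ℂ, IsSkewDir Y' ∧ IsPeriodicDir Y' ((N * L ^ (k + 1) : ℕ) : ℤ) ∧ dirIter L (k + 1) U Y' = 0 ∧
        |dAction U (fun y μ => Y' y μ - Y y μ) (perWin d (N * L ^ (k + 1)))|
          ≤ (a * ((curl1C d L / (1 - thetaLoc d L * (((L : ℝ) ^ (k + 1)) ^ 2 * x))) * (((L : ℝ) ^ (k + 1)) ^ d / ((L : ℝ) ^ (k + 1)) ^ 2)) * Λ)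
            * dirL1 Y (periodBox (d := d) (N * L ^ (k + 1))) := by
  intro Y hY hYP hYT
  obtain ⟨Y', hY's, hY'P, hY'T, hb⟩ := tangent_correction hL k hUu hUP hx hs hUx hθ hθl hε ha hUa hY hYP
  refine ⟨Y', hY's, hY'P, hY'T, hb.trans ?_⟩
  have hpos : 0 < 1 - thetaLoc d L * (((L : ℝ) ^ (k + 1)) ^ 2 * x) := by linarith
  have hc : 0 ≤ a * ((curl1C d L / (1 - thetaLoc d L * (((L : ℝ) ^ (k + 1)) ^ 2 * x))) * (((L : ℝ) ^ (k + 1)) ^ d / ((L : ℝ) ^ (k + 1)) ^ 2)) := by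
    have := curl1C_nonneg d L; positivity
  calc a * ((curl1C d L / (1 - thetaLoc d L * (((L : ℝ) ^ (k + 1)) ^ 2 * x))) * (((L : ℝ) ^ (k + 1)) ^ d / ((L : ℝ) ^ (k + 1)) ^ 2)
          * dirL1 (dirIter L (k + 1) U Y) (periodBox (d := d) N))
      = (a * ((curl1C d L / (1 - thetaLoc d L * (((L : ℝ) ^ (k + 1)) ^ 2 * x))) * (((L : ℝ) ^ (k + 1)) ^ d / ((L : ℝ) ^ (k + 1)) ^ 2)))
          * dirL1 (dirIter L (k + 1) U Y) (periodBox (d := d) N) := by ring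
    _ ≤ (a * ((curl1C d L / (1 - thetaLoc d L * (((L : ℝ) ^ (k + 1)) ^ 2 * x))) * (((L : ℝ) ^ (k + 1)) ^ d / ((L : ℝ) ^ (k + 1)) ^ 2)))
          * (Λ * dirL1 Y (periodBox (d := d) (N * L ^ (k + 1)))) := mul_le_mul_of_nonneg_left (hLip Y hY hYP hYT) hc
    _ = _ := by ring

end

end Summit.QuantumFields.BalabanUV.T4Continuum.NE7TangentTransport
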